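import Summits.CriticalPhenomena.PercolationContinuityZ3.Theorems.PercNearOneGluingNoHeavyLowerTailKnQuestion8CoefficientwiseRemSPPieces
import Summits.CriticalPhenomena.PercolationContinuityZ3.Theorems.PercNearOneGluingNoHeavyLowerTailKnQuestion8CoefficientwiseGluing
import Summits.CriticalPhenomena.PercolationContinuityZ3.Theorems.PercNearOneGluingNoHeavyLowerTailKnQuestion8CoefficientwiseTrivialCoreFlip
import HarnessLib

/-!
# THEOREM U3-CLOSURE, parallel step for the row `N`: the `N`-rows of two pieces glued at both terminals give the `N`-row of the union — prim-lf-2 gen 69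

Support file (`--supports stmt-CriticalPhenomena-4575`, closed), prover `prim-lf-2` (gen 69).  No definitions, no named facts, no sorries; standard axioms.
Memo `prim-lf-2/CW-SP-gen69.md` §4.2 (PARALLEL, ρN) with the definitions of `…CoefficientwiseRemSPPieces.lean`.

Setting: disjoint edge sets `D₁`, `D₂` whose edges can only share the terminals `x ≠ h` (parallel composition `D = D₁ ∪ D₂`); target set `W`.  For a colouring
`t = t₁ ⊔ t₂` of `D` in the class `N` (`h ∉ C_x t ∪ C_x(D∖t)`, …) NEITHER piece is red- or blue-through, so all four clusters split as plain unions
(`mem_openCluster_union_parallel`), the class condition reads `NB(t₁) ∧ NB(t₂) ∧ (xh(t₁) ∨ xh(t₂))` with `NB ∧ xh = pieceN` on the piece and `NB ∧ ¬xh` a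
complement-closed class; the row map is COMPONENTWISE: the piece's `N`-row map on a component in `pieceN`, the complement `Dᵢ ∖ tᵢ` on the other components.
* `Coefficientwise.hasDomRow_pieceN_parallel` — **if `pieceN` has a row on `(D₁;x,h)` and on `(D₂;x,h)` (for `W`) then on `(D₁ ∪ D₂; x, h)`**.
[cite: KozmaNitzan2024, Questions 8–9 (§5.5 p. 36) (context: the Question-8 pocket covariance programme)]
-/

namespace Summit.CriticalPhenomena.PercolationContinuityZ3.Theorems

open Finset Literature.Probability.Percolation

namespace Coefficientwise

variable {ι V : Type*} [DecidableEq ι] (ends : ι → Sym2 V)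

open Classical in
/-- **Parallel composition preserves the `N`-row.**  Let `D₁`, `D₂` be disjoint edge sets whose edges share only the vertices `x ≠ h`.  If the class `pieceN` has a
(strong) row on `(D₁; x, h)` and on `(D₂; x, h)` for the target set `W`, then it has one on `(D₁ ∪ D₂; x, h)`.
[cite: KozmaNitzan2024, Questions 8–9 (§5.5 p. 36) (context)] -/
theorem hasDomRow_pieceN_parallel {D₁ D₂ : Finset ι} (hdisj : Disjoint D₁ D₂) {x h : V} (hxh : x ≠ h)
    (hsep : ∀ e ∈ D₁, ∀ e' ∈ D₂, ∀ w : V, w ∈ ends e → w ∈ ends e' → w = x ∨ w = h) (W : Set V)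
    (h₁ : HasDomRow ends D₁ x (pieceN ends D₁ x h W)) (h₂ : HasDomRow ends D₂ x (pieceN ends D₂ x h W)) :
    HasDomRow ends (D₁ ∪ D₂) x (pieceN ends (D₁ ∪ D₂) x h W) := by
  obtain ⟨π₁, hm₁, hi₁, hd₁⟩ := h₁
  obtain ⟨π₂, hm₂, hi₂, hd₂⟩ := h₂
  set D : Finset ι := D₁ ∪ D₂ with hD
  -- notation
  set Cx : Finset ι → Set V := fun s => openCluster (ends '' (↑s : Set ι)) x with hCx
  set Ch : Finset ι → Set V := fun s => openCluster (ends '' (↑s : Set ι)) h with hCh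
  -- the piece-level predicates NB (base) and xh (the flag)
  set NB : Finset ι → Finset ι → Prop := fun E s => h ∉ Cx s ∧ h ∉ Cx (E \ s) ∧
      (∀ w ∈ W, ¬ (w ∈ Cx s ∧ w ∈ Cx (E \ s))) ∧ (∀ w ∈ W, ¬ (w ∈ Ch s ∧ w ∈ Cx (E \ s))) with hNB
  set XH : Finset ι → Finset ι → Prop := fun E s => ∃ w ∈ W, w ∈ Cx s ∧ w ∈ Ch (E \ s) with hXH
  have hN_iff : ∀ E s, pieceN ends E x h W s ↔ (NB E s ∧ XH E s) := by
    intro E s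
    unfold pieceN
    exact ⟨fun hh => ⟨⟨hh.1, hh.2.1, hh.2.2.1, hh.2.2.2.1⟩, hh.2.2.2.2⟩,
      fun hh => ⟨hh.1.1, hh.1.2.1, hh.1.2.2.1, hh.1.2.2.2, hh.2⟩⟩
  -- separation for sub-colourings
  have hsep' : ∀ s₁, s₁ ⊆ D₁ → ∀ s₂, s₂ ⊆ D₂ → ∀ e ∈ s₁, ∀ e' ∈ s₂, ∀ w : V, w ∈ ends e → w ∈ ends e' → w = x ∨ w = h :=
    fun s₁ hs₁ s₂ hs₂ e he e' he' w hw hw' => hsep e (hs₁ he) e' (hs₂ he') w hw hw'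
  have hsepH : ∀ s₁, s₁ ⊆ D₁ → ∀ s₂, s₂ ⊆ D₂ → ∀ e ∈ s₁, ∀ e' ∈ s₂, ∀ w : V, w ∈ ends e → w ∈ ends e' → w = h ∨ w = x :=
    fun s₁ hs₁ s₂ hs₂ e he e' he' w hw hw' => (hsep' s₁ hs₁ s₂ hs₂ e he e' he' w hw hw').symm
  -- splitting of the clusters when h is not reached (x-clusters) / x not reached (h-clusters)
  have splitX : ∀ s₁, s₁ ⊆ D₁ → ∀ s₂, s₂ ⊆ D₂ → h ∉ Cx s₁ → h ∉ Cx s₂ → ∀ y, (y ∈ Cx (s₁ ∪ s₂) ↔ y ∈ Cx s₁ ∨ y ∈ Cx s₂) :=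
    fun s₁ hs₁ s₂ hs₂ hh1 hh2 y => mem_openCluster_union_parallel ends (hsep' s₁ hs₁ s₂ hs₂) hh1 hh2 y
  have splitH : ∀ s₁, s₁ ⊆ D₁ → ∀ s₂, s₂ ⊆ D₂ → h ∉ Cx s₁ → h ∉ Cx s₂ → ∀ y, (y ∈ Ch (s₁ ∪ s₂) ↔ y ∈ Ch s₁ ∨ y ∈ Ch s₂) := by
    intro s₁ hs₁ s₂ hs₂ hh1 hh2 y
    have hx1 : x ∉ Ch s₁ := fun hx => hh1 ((mem_openCluster_comm ends s₁ h x).mp hx)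
    have hx2 : x ∉ Ch s₂ := fun hx => hh2 ((mem_openCluster_comm ends s₂ h x).mp hx)
    exact mem_openCluster_union_parallel ends (hsepH s₁ hs₁ s₂ hs₂) hx1 hx2 y
  -- decomposition of colourings of D
  have hdecomp : ∀ t, t ⊆ D → t = (t ∩ D₁) ∪ (t ∩ D₂) := by
    intro t ht; ext i
    simp only [Finset.mem_union, Finset.mem_inter]
    constructor
    · intro hi; rcases Finset.mem_union.mp (ht hi) with h1 | h2
      · exact Or.inl ⟨hi, h1⟩
      · exact Or.inr ⟨hi, h2⟩
    · rintro (⟨hi, _⟩ | ⟨hi, _⟩) <;> exact hi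
  have hsdiff : ∀ s₁, s₁ ⊆ D₁ → ∀ s₂, s₂ ⊆ D₂ → D \ (s₁ ∪ s₂) = (D₁ \ s₁) ∪ (D₂ \ s₂) :=
    fun s₁ hs₁ s₂ hs₂ => union_sdiff_union_of_subset hdisj hs₁ hs₂
  have hinter₁ : ∀ s₁, s₁ ⊆ D₁ → ∀ s₂, s₂ ⊆ D₂ → (s₁ ∪ s₂) ∩ D₁ = s₁ := by
    intro s₁ hs₁ s₂ hs₂; ext i
    simp only [Finset.mem_inter, Finset.mem_union]
    constructor
    · rintro ⟨h12 | h12, hi1⟩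
      · exact h12
      · exact absurd (Finset.mem_inter.mpr ⟨hi1, hs₂ h12⟩) (Finset.disjoint_iff_inter_eq_empty.mp hdisj ▸ Finset.notMem_empty i)
    · intro hi; exact ⟨Or.inl hi, hs₁ hi⟩
  have hinter₂ : ∀ s₁, s₁ ⊆ D₁ → ∀ s₂, s₂ ⊆ D₂ → (s₁ ∪ s₂) ∩ D₂ = s₂ := by
    intro s₁ hs₁ s₂ hs₂; ext i
    simp only [Finset.mem_inter, Finset.mem_union]
    constructor
    · rintro ⟨h12 | h12, hi2⟩
      · exact absurd (Finset.mem_inter.mpr ⟨hs₁ h12, hi2⟩) (Finset.disjoint_iff_inter_eq_empty.mp hdisj ▸ Finset.notMem_empty i)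
      · exact h12
    · intro hi; exact ⟨Or.inr hi, hs₂ hi⟩
  -- a vertex common to a cluster inside D₁-edges and a cluster inside D₂-edges is a terminal
  have cross : ∀ s₁, s₁ ⊆ D₁ → ∀ s₂, s₂ ⊆ D₂ → ∀ (a b w : V), w ∈ openCluster (ends '' (↑s₁ : Set ι)) a →
      w ∈ openCluster (ends '' (↑s₂ : Set ι)) b → w = a ∨ w = b ∨ w = x ∨ w = h := by
    intro s₁ hs₁ s₂ hs₂ a b w hwa hwb
    by_cases hwa' : w = a
    · exact Or.inl hwa'
    by_cases hwb' : w = b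
    · exact Or.inr (Or.inl hwb')
    obtain ⟨e, he, hwe⟩ := exists_edge_of_mem_openCluster ends hwa hwa'
    obtain ⟨e', he', hwe'⟩ := exists_edge_of_mem_openCluster ends hwb hwb'
    exact Or.inr (Or.inr (hsep' s₁ hs₁ s₂ hs₂ e he e' he' w hwe hwe'))
  -- CHARACTERISATION of the composite class: for t ⊆ D with t₁ = t ∩ D₁, t₂ = t ∩ D₂
  have char_fwd : ∀ t, t ⊆ D → pieceN ends D x h W t →
      (NB D₁ (t ∩ D₁) ∧ NB D₂ (t ∩ D₂) ∧ (XH D₁ (t ∩ D₁) ∨ XH D₂ (t ∩ D₂))) := by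
    intro t ht hN
    set t₁ := t ∩ D₁ with ht₁
    set t₂ := t ∩ D₂ with ht₂
    have ht₁D : t₁ ⊆ D₁ := Finset.inter_subset_right
    have ht₂D : t₂ ⊆ D₂ := Finset.inter_subset_right
    have htt : t = t₁ ∪ t₂ := hdecomp t ht
    obtain ⟨hhK, hhB, hxx, hhx, ⟨w0, hw0W, hw0K, hw0P⟩⟩ := hN
    rw [htt] at hhK hhB hxx hhx hw0K hw0P
    rw [hsdiff t₁ ht₁D t₂ ht₂D] at hhB hxx hhx hw0P
    -- h not reached in either piece, either colour
    have hhK1 : h ∉ Cx t₁ := fun hh => hhK (openCluster_image_mono ends Finset.subset_union_left x hh)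
    have hhK2 : h ∉ Cx t₂ := fun hh => hhK (openCluster_image_mono ends Finset.subset_union_right x hh)
    have hhB1 : h ∉ Cx (D₁ \ t₁) := fun hh => hhB (openCluster_image_mono ends Finset.subset_union_left x hh)
    have hhB2 : h ∉ Cx (D₂ \ t₂) := fun hh => hhB (openCluster_image_mono ends Finset.subset_union_right x hh)
    have sK := splitX t₁ ht₁D t₂ ht₂D hhK1 hhK2
    have sB := splitX (D₁ \ t₁) Finset.sdiff_subset (D₂ \ t₂) Finset.sdiff_subset hhB1 hhB2
    have sP := splitH t₁ ht₁D t₂ ht₂D hhK1 hhK2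
    have sP' := splitH (D₁ \ t₁) Finset.sdiff_subset (D₂ \ t₂) Finset.sdiff_subset hhB1 hhB2
    have NB1 : NB D₁ t₁ := by
      refine ⟨hhK1, hhB1, fun w hw hh => hxx w hw ⟨(sK w).mpr (Or.inl hh.1), (sB w).mpr (Or.inl hh.2)⟩,
        fun w hw hh => hhx w hw ⟨(sP w).mpr (Or.inl hh.1), (sB w).mpr (Or.inl hh.2)⟩⟩
    have NB2 : NB D₂ t₂ := by
      refine ⟨hhK2, hhB2, fun w hw hh => hxx w hw ⟨(sK w).mpr (Or.inr hh.1), (sB w).mpr (Or.inr hh.2)⟩,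
        fun w hw hh => hhx w hw ⟨(sP w).mpr (Or.inr hh.1), (sB w).mpr (Or.inr hh.2)⟩⟩
    refine ⟨NB1, NB2, ?_⟩
    -- the witness lies in one piece
    rcases (sK w0).mp hw0K with hK1 | hK2
    · rcases (sP' w0).mp hw0P with hP1 | hP2
      · exact Or.inl ⟨w0, hw0W, hK1, hP1⟩
      · -- w0 ∈ Cx t₁ ∩ Ch(D₂∖t₂): a terminal — impossible
        exfalso
        rcases cross t₁ ht₁D (D₂ \ t₂) Finset.sdiff_subset x h w0 hK1 hP2 with rfl | rfl | rfl | rfl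
        · exact hhB2 ((mem_openCluster_comm ends (D₂ \ t₂) h _).mp hP2)
        · exact hhK1 hK1
        · exact hhB2 ((mem_openCluster_comm ends (D₂ \ t₂) h _).mp hP2)
        · exact hhK1 hK1
    · rcases (sP' w0).mp hw0P with hP1 | hP2
      · exfalso
        rcases cross (D₁ \ t₁) Finset.sdiff_subset t₂ ht₂D h x w0 hP1 hK2 with rfl | rfl | rfl | rfl
        · exact hhK2 hK2
        · exact hhB1 ((mem_openCluster_comm ends (D₁ \ t₁) h _).mp hP1)
        · exact hhB1 ((mem_openCluster_comm ends (D₁ \ t₁) h _).mp hP1)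
        · exact hhK2 hK2
      · exact Or.inr ⟨w0, hw0W, hK2, hP2⟩
  have char_bwd : ∀ s₁, s₁ ⊆ D₁ → ∀ s₂, s₂ ⊆ D₂ → NB D₁ s₁ → NB D₂ s₂ → (XH D₁ s₁ ∨ XH D₂ s₂) →
      pieceN ends D x h W (s₁ ∪ s₂) := by
    intro s₁ hs₁ s₂ hs₂ hN1 hN2 hX
    obtain ⟨hK1, hB1, hxx1, hhx1⟩ := hN1
    obtain ⟨hK2, hB2, hxx2, hhx2⟩ := hN2
    have sK := splitX s₁ hs₁ s₂ hs₂ hK1 hK2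
    have sB := splitX (D₁ \ s₁) Finset.sdiff_subset (D₂ \ s₂) Finset.sdiff_subset hB1 hB2
    have sP := splitH s₁ hs₁ s₂ hs₂ hK1 hK2
    have sP' := splitH (D₁ \ s₁) Finset.sdiff_subset (D₂ \ s₂) Finset.sdiff_subset hB1 hB2
    -- x is not a target (else NB1's no-core condition fails at w = x)
    have hxW : x ∉ W := fun hxW => hxx1 x hxW ⟨mem_openCluster_self _ x, mem_openCluster_self _ x⟩
    refine ⟨?_, ?_, ?_, ?_, ?_⟩
    · intro hh; rcases (sK h).mp hh with h1 | h2
      · exact hK1 h1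
      · exact hK2 h2
    · rw [hsdiff s₁ hs₁ s₂ hs₂]; intro hh; rcases (sB h).mp hh with h1 | h2
      · exact hB1 h1
      · exact hB2 h2
    · intro w hw hh
      rw [hsdiff s₁ hs₁ s₂ hs₂] at hh
      obtain ⟨hwK, hwB⟩ := hh
      rcases (sK w).mp hwK with k1 | k2 <;> rcases (sB w).mp hwB with b1 | b2
      · exact hxx1 w hw ⟨k1, b1⟩
      · rcases cross s₁ hs₁ (D₂ \ s₂) Finset.sdiff_subset x x w k1 b2 with rfl | rfl | rfl | rfl
        · exact hxW hw
        · exact hxW hw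
        · exact hxW hw
        · exact hK1 k1
      · rcases cross (D₁ \ s₁) Finset.sdiff_subset s₂ hs₂ x x w b1 k2 with rfl | rfl | rfl | rfl
        · exact hxW hw
        · exact hxW hw
        · exact hxW hw
        · exact hK2 k2
      · exact hxx2 w hw ⟨k2, b2⟩
    · intro w hw hh
      rw [hsdiff s₁ hs₁ s₂ hs₂] at hh
      obtain ⟨hwP, hwB⟩ := hh
      rcases (sP w).mp hwP with p1 | p2 <;> rcases (sB w).mp hwB with b1 | b2
      · exact hhx1 w hw ⟨p1, b1⟩
      · rcases cross s₁ hs₁ (D₂ \ s₂) Finset.sdiff_subset h x w p1 b2 with rfl | rfl | rfl | rfl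
        · exact hB2 b2
        · exact hxW hw
        · exact hxW hw
        · exact hB2 b2
      · rcases cross (D₁ \ s₁) Finset.sdiff_subset s₂ hs₂ x h w b1 p2 with rfl | rfl | rfl | rfl
        · exact hxW hw
        · exact hB1 b1
        · exact hxW hw
        · exact hB1 b1
      · exact hhx2 w hw ⟨p2, b2⟩
    · rcases hX with ⟨w, hw, hwK, hwP⟩ | ⟨w, hw, hwK, hwP⟩
      · refine ⟨w, hw, (sK w).mpr (Or.inl hwK), ?_⟩
        rw [hsdiff s₁ hs₁ s₂ hs₂]; exact (sP' w).mpr (Or.inl hwP)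
      · refine ⟨w, hw, (sK w).mpr (Or.inr hwK), ?_⟩
        rw [hsdiff s₁ hs₁ s₂ hs₂]; exact (sP' w).mpr (Or.inr hwP)
  -- the complement class SYM = NB ∧ ¬XH is complement-closed
  have sym_compl : ∀ (E s : Finset ι), s ⊆ E → NB E s → ¬ XH E s → (NB E (E \ s) ∧ ¬ XH E (E \ s)) := by
    intro E s hs hN hX
    obtain ⟨hK, hB, hxx, hhx⟩ := hN
    rw [hNB, hXH]; simp only [Finset.sdiff_sdiff_eq_self hs]
    refine ⟨⟨hB, hK, fun w hw hh => hxx w hw ⟨hh.2, hh.1⟩, fun w hw hh => hX ⟨w, hw, hh.2, hh.1⟩⟩, ?_⟩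
    rintro ⟨w, hw, hwB, hwP⟩
    exact hhx w hw ⟨hwP, hwB⟩
  -- the componentwise maps
  set f₁ : Finset ι → Finset ι := fun s => if pieceN ends D₁ x h W s then π₁ s else D₁ \ s with hf₁
  set f₂ : Finset ι → Finset ι := fun s => if pieceN ends D₂ x h W s then π₂ s else D₂ \ s with hf₂
  set Pm : Finset ι → Finset ι := fun t => f₁ (t ∩ D₁) ∪ f₂ (t ∩ D₂) with hPm
  -- properties of f₁ / f₂ on NB-colourings
  have f_props : ∀ (E : Finset ι) (πE f : Finset ι → Finset ι),
      (∀ s, s ⊆ E → pieceN ends E x h W s → (πE s ⊆ E ∧ pieceN ends E x h W (πE s))) →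
      (∀ s, s ⊆ E → pieceN ends E x h W s → Cx (E \ s) ⊆ Cx (πE s)) →
      (f = fun s => if pieceN ends E x h W s then πE s else E \ s) →
      ∀ s, s ⊆ E → NB E s →
        (f s ⊆ E ∧ NB E (f s) ∧ (XH E (f s) ↔ XH E s) ∧ Cx (E \ s) ⊆ Cx (f s)) := by
    intro E πE f hmE hdE hf s hs hNs
    by_cases hXs : XH E s
    · have hPs : pieceN ends E x h W s := (hN_iff E s).mpr ⟨hNs, hXs⟩
      have hfs : f s = πE s := by rw [hf]; exact if_pos hPs
      rw [hfs]
      obtain ⟨hsub, hP'⟩ := hmE s hs hPs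
      obtain ⟨hN', hX'⟩ := (hN_iff E _).mp hP'
      exact ⟨hsub, hN', ⟨fun _ => hXs, fun _ => hX'⟩, hdE s hs hPs⟩
    · have hPs : ¬ pieceN ends E x h W s := fun hP => hXs ((hN_iff E s).mp hP).2
      have hfs : f s = E \ s := by rw [hf]; exact if_neg hPs
      rw [hfs]
      obtain ⟨hN', hX'⟩ := sym_compl E s hs hNs hXs
      exact ⟨Finset.sdiff_subset, hN', ⟨fun hX => absurd hX hX', fun hX => absurd hX hXs⟩, le_rfl⟩
  have f₁_props := f_props D₁ π₁ f₁ hm₁ hd₁ hf₁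
  have f₂_props := f_props D₂ π₂ f₂ hm₂ hd₂ hf₂
  -- injectivity of fᵢ on NB-colourings
  have f_inj : ∀ (E : Finset ι) (πE f : Finset ι → Finset ι),
      (∀ s, s ⊆ E → pieceN ends E x h W s → (πE s ⊆ E ∧ pieceN ends E x h W (πE s))) →
      (∀ s₁ s₂, s₁ ⊆ E → pieceN ends E x h W s₁ → s₂ ⊆ E → pieceN ends E x h W s₂ → πE s₁ = πE s₂ → s₁ = s₂) →
      (f = fun s => if pieceN ends E x h W s then πE s else E \ s) →
      ∀ s s', s ⊆ E → NB E s → s' ⊆ E → NB E s' → f s = f s' → s = s' := by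
    intro E πE f hmE hiE hf s s' hs hNs hs' hNs' heq
    by_cases hX : XH E s <;> by_cases hX' : XH E s'
    · have hP : pieceN ends E x h W s := (hN_iff E s).mpr ⟨hNs, hX⟩
      have hP' : pieceN ends E x h W s' := (hN_iff E s').mpr ⟨hNs', hX'⟩
      have e1 : f s = πE s := by rw [hf]; exact if_pos hP
      have e2 : f s' = πE s' := by rw [hf]; exact if_pos hP'
      rw [e1, e2] at heq
      exact hiE s s' hs hP hs' hP' heq
    · exfalso
      have hP : pieceN ends E x h W s := (hN_iff E s).mpr ⟨hNs, hX⟩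
      have hP' : ¬ pieceN ends E x h W s' := fun hP' => hX' ((hN_iff E s').mp hP').2
      have e1 : f s = πE s := by rw [hf]; exact if_pos hP
      have e2 : f s' = E \ s' := by rw [hf]; exact if_neg hP'
      rw [e1, e2] at heq
      have hX1 : XH E (πE s) := ((hN_iff E _).mp (hmE s hs hP).2).2
      rw [heq] at hX1
      exact (sym_compl E s' hs' hNs' hX').2 hX1
    · exfalso
      have hP' : pieceN ends E x h W s' := (hN_iff E s').mpr ⟨hNs', hX'⟩
      have hP : ¬ pieceN ends E x h W s := fun hP => hX ((hN_iff E s).mp hP).2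
      have e1 : f s = E \ s := by rw [hf]; exact if_neg hP
      have e2 : f s' = πE s' := by rw [hf]; exact if_pos hP'
      rw [e1, e2] at heq
      have hX1 : XH E (πE s') := ((hN_iff E _).mp (hmE s' hs' hP').2).2
      rw [← heq] at hX1
      exact (sym_compl E s hs hNs hX).2 hX1
    · have hP : ¬ pieceN ends E x h W s := fun hP => hX ((hN_iff E s).mp hP).2
      have hP' : ¬ pieceN ends E x h W s' := fun hP' => hX' ((hN_iff E s').mp hP').2
      have e1 : f s = E \ s := by rw [hf]; exact if_neg hP
      have e2 : f s' = E \ s' := by rw [hf]; exact if_neg hP'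
      rw [e1, e2] at heq
      rw [← Finset.sdiff_sdiff_eq_self hs, heq, Finset.sdiff_sdiff_eq_self hs']
  have f₁_inj := f_inj D₁ π₁ f₁ hm₁ hi₁ hf₁
  have f₂_inj := f_inj D₂ π₂ f₂ hm₂ hi₂ hf₂
  -- THE ROW
  refine ⟨Pm, ?_, ?_, ?_⟩
  · -- maps the class into itself
    intro t ht hN
    obtain ⟨NB1, NB2, hX⟩ := char_fwd t ht hN
    obtain ⟨hs1, hN1, hX1, -⟩ := f₁_props (t ∩ D₁) Finset.inter_subset_right NB1
    obtain ⟨hs2, hN2, hX2, -⟩ := f₂_props (t ∩ D₂) Finset.inter_subset_right NB2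
    refine ⟨Finset.union_subset_union hs1 hs2, ?_⟩
    exact char_bwd _ hs1 _ hs2 hN1 hN2 (hX.imp hX1.mpr hX2.mpr)
  · -- injective on the class
    intro t t' ht hN ht' hN' heq
    obtain ⟨NB1, NB2, -⟩ := char_fwd t ht hN
    obtain ⟨NB1', NB2', -⟩ := char_fwd t' ht' hN'
    have hs1 := (f₁_props (t ∩ D₁) Finset.inter_subset_right NB1).1
    have hs2 := (f₂_props (t ∩ D₂) Finset.inter_subset_right NB2).1
    have hs1' := (f₁_props (t' ∩ D₁) Finset.inter_subset_right NB1').1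
    have hs2' := (f₂_props (t' ∩ D₂) Finset.inter_subset_right NB2').1
    have e1 : f₁ (t ∩ D₁) = f₁ (t' ∩ D₁) := by
      have := congrArg (fun s => s ∩ D₁) heq
      simp only [hPm] at this
      rwa [hinter₁ _ hs1 _ hs2, hinter₁ _ hs1' _ hs2'] at this
    have e2 : f₂ (t ∩ D₂) = f₂ (t' ∩ D₂) := by
      have := congrArg (fun s => s ∩ D₂) heq
      simp only [hPm] at this
      rwa [hinter₂ _ hs1 _ hs2, hinter₂ _ hs1' _ hs2'] at this
    have q1 := f₁_inj _ _ Finset.inter_subset_right NB1 Finset.inter_subset_right NB1' e1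
    have q2 := f₂_inj _ _ Finset.inter_subset_right NB2 Finset.inter_subset_right NB2' e2
    rw [hdecomp t ht, hdecomp t' ht', q1, q2]
  · -- domination
    intro t ht hN y hy
    obtain ⟨NB1, NB2, -⟩ := char_fwd t ht hN
    obtain ⟨hs1, -, -, hdom1⟩ := f₁_props (t ∩ D₁) Finset.inter_subset_right NB1
    obtain ⟨hs2, -, -, hdom2⟩ := f₂_props (t ∩ D₂) Finset.inter_subset_right NB2
    rw [hdecomp t ht, hsdiff _ Finset.inter_subset_right _ Finset.inter_subset_right] at hy
    have sB := splitX (D₁ \ (t ∩ D₁)) Finset.sdiff_subset (D₂ \ (t ∩ D₂)) Finset.sdiff_subset NB1.2.1 NB2.2.1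
    rcases (sB y).mp hy with hy1 | hy2
    · exact openCluster_image_mono ends Finset.subset_union_left x (hdom1 hy1)
    · exact openCluster_image_mono ends Finset.subset_union_right x (hdom2 hy2)

end Coefficientwise

end Summit.CriticalPhenomena.PercolationContinuityZ3.Theorems
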